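import Literature.Analysis.FunctionSpaces.TorusCommutatorEstimate
import HarnessLib

/-!
# Limits of weighted `L²` energies and of `L^{3/2} · L³` pairings

Analysis/FunctionSpaces support file (serves the discharge of Onsager rigidity,
`Literature.Analysis.FluidPDE.onsager_rigidity`, `FluidPDE/Onsager`: removal of the time mollification in the
mollified energy balance, where the mollified fields converge in `L²`, the mollified momentum
fluxes in `L^{3/2}` and the mollified velocity gradients in `L³`; Constantin–E–Titi 1994, p. 209).
On a general measure space:

* `Literature.Analysis.FunctionSpaces.tendsto_integral_mul_norm_sq` — if `fₙ → g` in `L²` then `∫ c ‖fₙ‖² → ∫ c ‖g‖²` for every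
  bounded measurable weight `c`;
* `Literature.Analysis.FunctionSpaces.tendsto_integral_mul_mul` — if `Aₙ → A` in `L^{3/2}` and `Bₙ → B` in `L³` then
  `∫ c Aₙ Bₙ → ∫ c A B` for every bounded measurable weight `c` (Hölder `(3/2, 3, 1)`).

## Mathlib search

Mathlib (this pin) has Hölder's inequality (`ENNReal.lintegral_mul_le_Lp_mul_Lq`,
`eLpNorm_smul_le_mul_eLpNorm`) and continuity of the `L^p` norm, but no ready-made statement
that bilinear pairings of `L^p`-convergent sequences converge (searched `tendsto_integral` +
`eLpNorm`, `Tendsto` + `inner` in `MeasureTheory/Function/LpSpace`, `L2Space`).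

## References

* P. Constantin, W. E, E. S. Titi, *Onsager's conjecture on the energy conservation for solutions
  of Euler's equation*, Comm. Math. Phys. 165 (1994), 207–209, p. 209.
-/

noncomputable section

open MeasureTheory TopologicalSpace Set Function Filter Topology
open scoped ENNReal NNReal

namespace Literature.Analysis.FunctionSpaces

variable {X : Type*} [MeasurableSpace X] {μ : Measure X}

/-! ## Real integrals against `ℝ≥0∞` bounds -/

/-- `|∫ f| ≤ (∫⁻ ‖f‖ₑ).toReal`. [folklore] -/
theorem abs_integral_le_toReal_lintegral (f : X → ℝ) :
    |∫ x, f x ∂μ| ≤ (∫⁻ x, ‖f x‖ₑ ∂μ).toReal := by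
  have h := norm_integral_le_lintegral_norm (μ := μ) f
  simp_rw [ofReal_norm] at h
  simpa only [Real.norm_eq_abs] using h

/-! ## Weighted `L²` energies -/

section L2

variable {E' : Type*} [NormedAddCommGroup E']

/-- `(∫⁻ ‖h‖ₑ²)^{1/2} = ‖h‖_{L²}`. [folklore] -/
theorem lintegral_rpow_two_eq_eLpNorm (h : X → E') :
    (∫⁻ x, ‖h x‖ₑ ^ (2 : ℝ) ∂μ) ^ (1 / (2 : ℝ)) = eLpNorm h 2 μ := by
  rw [eLpNorm_eq_lintegral_rpow_enorm_toReal two_ne_zero ENNReal.ofNat_ne_top, ENNReal.toReal_ofNat]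

/-- **The energy-difference bound**: for `g ∈ L²`, `f - g ∈ L²` and a bounded measurable weight
`c`, `|∫ c ‖f‖² - ∫ c ‖g‖²| ≤ C ‖f - g‖₂ (‖f - g‖₂ + 2‖g‖₂)`
(`|‖a‖² - ‖b‖²| ≤ ‖a - b‖ (‖a‖ + ‖b‖)` and Cauchy–Schwarz). [folklore] -/
theorem abs_integral_mul_norm_sq_sub_le {f g : X → E'} (hf : AEStronglyMeasurable f μ)
    (hg : MemLp g 2 μ) (hfin : eLpNorm (f - g) 2 μ < ⊤) {c : X → ℝ}
    (hc : AEStronglyMeasurable c μ) {C : ℝ} (hC0 : 0 ≤ C) (hC : ∀ x, ‖c x‖ ≤ C) :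
    |(∫ x, c x * ‖f x‖ ^ 2 ∂μ) - ∫ x, c x * ‖g x‖ ^ 2 ∂μ| ≤
      (ENNReal.ofReal C * (eLpNorm (f - g) 2 μ * (eLpNorm (f - g) 2 μ + 2 * eLpNorm g 2 μ))).toReal := by
  -- `f ∈ L²`, so both integrals exist
  have hfg : MemLp (f - g) 2 μ := ⟨hf.sub hg.1, hfin⟩
  have hfm : MemLp f 2 μ := by simpa using hfg.add hg
  have hif : Integrable (fun x => c x * ‖f x‖ ^ 2) μ :=
    ((memLp_two_iff_integrable_sq_norm hfm.1).1 hfm).bdd_mul hc (Eventually.of_forall hC)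
  have hig : Integrable (fun x => c x * ‖g x‖ ^ 2) μ :=
    ((memLp_two_iff_integrable_sq_norm hg.1).1 hg).bdd_mul hc (Eventually.of_forall hC)
  rw [← integral_sub hif hig]
  refine (abs_integral_le_toReal_lintegral _).trans (ENNReal.toReal_mono ?_ ?_)
  · exact ENNReal.mul_ne_top ENNReal.ofReal_ne_top (ENNReal.mul_ne_top hfin.ne
      (ENNReal.add_ne_top.2 ⟨hfin.ne, ENNReal.mul_ne_top ENNReal.ofNat_ne_top hg.2.ne⟩))
  -- pointwise bound `‖c (‖f‖² - ‖g‖²)‖ₑ ≤ C ‖f - g‖ₑ (‖f‖ₑ + ‖g‖ₑ)`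
  have hpt : ∀ x, ‖c x * ‖f x‖ ^ 2 - c x * ‖g x‖ ^ 2‖ₑ ≤
      ENNReal.ofReal C * (‖f x - g x‖ₑ * (‖f x‖ₑ + ‖g x‖ₑ)) := fun x => by
    rw [← ofReal_norm, ← ofReal_norm, ← ofReal_norm, ← ofReal_norm,
      ← ENNReal.ofReal_add (norm_nonneg _) (norm_nonneg _),
      ← ENNReal.ofReal_mul (norm_nonneg _), ← ENNReal.ofReal_mul hC0]
    refine ENNReal.ofReal_le_ofReal ?_
    rw [← mul_sub, norm_mul, Real.norm_eq_abs (‖f x‖ ^ 2 - ‖g x‖ ^ 2),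
      show ‖f x‖ ^ 2 - ‖g x‖ ^ 2 = (‖f x‖ - ‖g x‖) * (‖f x‖ + ‖g x‖) by ring, abs_mul,
      abs_of_nonneg (add_nonneg (norm_nonneg _) (norm_nonneg _))]
    refine mul_le_mul (hC x) (mul_le_mul_of_nonneg_right (abs_norm_sub_norm_le _ _)
      (add_nonneg (norm_nonneg _) (norm_nonneg _))) (by positivity) hC0
  -- integrate and apply Cauchy–Schwarz
  have hF : AEMeasurable (fun x => ‖f x - g x‖ₑ) μ := (hf.sub hg.1).enorm
  have hG : AEMeasurable (fun x => ‖f x‖ₑ + ‖g x‖ₑ) μ := hf.enorm.add hg.1.enorm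
  calc ∫⁻ x, ‖c x * ‖f x‖ ^ 2 - c x * ‖g x‖ ^ 2‖ₑ ∂μ
      ≤ ∫⁻ x, ENNReal.ofReal C * (‖f x - g x‖ₑ * (‖f x‖ₑ + ‖g x‖ₑ)) ∂μ := lintegral_mono hpt
    _ = ENNReal.ofReal C * ∫⁻ x, ‖f x - g x‖ₑ * (‖f x‖ₑ + ‖g x‖ₑ) ∂μ :=
        lintegral_const_mul'' _ (hF.mul hG)
    _ ≤ ENNReal.ofReal C * ((∫⁻ x, ‖f x - g x‖ₑ ^ (2 : ℝ) ∂μ) ^ (1 / (2 : ℝ)) *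
          (∫⁻ x, (‖f x‖ₑ + ‖g x‖ₑ) ^ (2 : ℝ) ∂μ) ^ (1 / (2 : ℝ))) := by
        gcongr
        exact ENNReal.lintegral_mul_le_Lp_mul_Lq μ Real.HolderConjugate.two_two hF hG
    _ ≤ ENNReal.ofReal C * (eLpNorm (f - g) 2 μ * (eLpNorm (f - g) 2 μ + 2 * eLpNorm g 2 μ)) := by
        gcongr ENNReal.ofReal C * (?_ * ?_)
        · exact (lintegral_rpow_two_eq_eLpNorm (f - g)).le
        · -- `‖ ‖f‖ + ‖g‖ ‖₂ ≤ ‖f‖₂ + ‖g‖₂ ≤ (‖f - g‖₂ + ‖g‖₂) + ‖g‖₂`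
          have h1 : (∫⁻ x, (‖f x‖ₑ + ‖g x‖ₑ) ^ (2 : ℝ) ∂μ) ^ (1 / (2 : ℝ)) =
              eLpNorm (fun x => ‖f x‖ + ‖g x‖) 2 μ := by
            rw [← lintegral_rpow_two_eq_eLpNorm]
            congr 1
            refine lintegral_congr fun x => ?_
            rw [Real.enorm_of_nonneg (add_nonneg (norm_nonneg _) (norm_nonneg _)),
              ENNReal.ofReal_add (norm_nonneg _) (norm_nonneg _), ofReal_norm, ofReal_norm]
          rw [h1]
          calc eLpNorm (fun x => ‖f x‖ + ‖g x‖) 2 μ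
              ≤ eLpNorm (fun x => ‖f x‖) 2 μ + eLpNorm (fun x => ‖g x‖) 2 μ :=
                eLpNorm_add_le hf.norm hg.1.norm one_le_two
            _ = eLpNorm f 2 μ + eLpNorm g 2 μ := by rw [eLpNorm_norm, eLpNorm_norm]
            _ ≤ (eLpNorm (f - g) 2 μ + eLpNorm g 2 μ) + eLpNorm g 2 μ := by
                gcongr
                have h := eLpNorm_add_le (hf.sub hg.1) hg.1 one_le_two (μ := μ)
                simpa using h
            _ = eLpNorm (f - g) 2 μ + 2 * eLpNorm g 2 μ := by ring

/-- **Weighted energies converge along `L²`-convergent sequences**: if `‖fₙ - g‖_{L²} → 0` with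
`g ∈ L²` and `c` is a bounded measurable weight, then `∫ c ‖fₙ‖² → ∫ c ‖g‖²`. [folklore] -/
theorem tendsto_integral_mul_norm_sq {f : ℕ → X → E'} {g : X → E'}
    (hf : ∀ n, AEStronglyMeasurable (f n) μ) (hg : MemLp g 2 μ)
    (hlim : Tendsto (fun n => eLpNorm (f n - g) 2 μ) atTop (𝓝 0)) {c : X → ℝ}
    (hc : AEStronglyMeasurable c μ) {C : ℝ} (hC0 : 0 ≤ C) (hC : ∀ x, ‖c x‖ ≤ C) :
    Tendsto (fun n => ∫ x, c x * ‖f n x‖ ^ 2 ∂μ) atTop (𝓝 (∫ x, c x * ‖g x‖ ^ 2 ∂μ)) := by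
  -- the bound tends to `0`
  set B : ℕ → ℝ≥0∞ := fun n => ENNReal.ofReal C *
    (eLpNorm (f n - g) 2 μ * (eLpNorm (f n - g) 2 μ + 2 * eLpNorm g 2 μ)) with hB
  have hG : 2 * eLpNorm g 2 μ ≠ ⊤ := ENNReal.mul_ne_top ENNReal.ofNat_ne_top hg.2.ne
  have hBt : Tendsto B atTop (𝓝 0) := by
    have h1 : Tendsto (fun n => eLpNorm (f n - g) 2 μ + 2 * eLpNorm g 2 μ) atTop
        (𝓝 (0 + 2 * eLpNorm g 2 μ)) := hlim.add tendsto_const_nhds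
    have h2 := ENNReal.Tendsto.mul hlim (Or.inr (by simpa using hG)) h1 (Or.inr ENNReal.zero_ne_top)
    rw [zero_mul] at h2
    have h3 := ENNReal.Tendsto.const_mul (a := ENNReal.ofReal C) h2 (Or.inr ENNReal.ofReal_ne_top)
    simpa [hB] using h3
  have hBr : Tendsto (fun n => (B n).toReal) atTop (𝓝 0) := by
    have h := (ENNReal.tendsto_toReal ENNReal.zero_ne_top).comp hBt
    rw [ENNReal.toReal_zero] at h
    exact h
  -- eventually the `L²` distance is finite and the bound applies
  have hev : ∀ᶠ n in atTop, eLpNorm (f n - g) 2 μ < ⊤ := by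
    filter_upwards [hlim (gt_mem_nhds (show (0 : ℝ≥0∞) < 1 from one_pos))] with n hn
    exact lt_trans hn ENNReal.one_lt_top
  rw [tendsto_iff_norm_sub_tendsto_zero]
  refine squeeze_zero' (Eventually.of_forall fun n => norm_nonneg _) ?_ hBr
  filter_upwards [hev] with n hn
  rw [Real.norm_eq_abs]
  exact abs_integral_mul_norm_sq_sub_le (hf n) hg hn hc hC0 hC

end L2

/-! ## `L^{3/2} · L³` pairings -/

section Pairing

/-- **The pairing-difference bound**: for real `A, A' ∈ L^{3/2}`, `B, B' ∈ L³` and a bounded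
measurable weight `c`,
`|∫ c A B - ∫ c A' B'| ≤ C (‖A - A'‖_{3/2} (‖B - B'‖₃ + ‖B'‖₃) + ‖A'‖_{3/2} ‖B - B'‖₃)`
(`AB - A'B' = (A - A')B + A'(B - B')` and Hölder `(3/2, 3, 1)`). [folklore] -/
theorem abs_integral_mul_mul_sub_le {A A' B B' : X → ℝ} (hAm : AEStronglyMeasurable A μ)
    (hA'm : AEStronglyMeasurable A' μ) (hBm : AEStronglyMeasurable B μ)
    (hB'm : AEStronglyMeasurable B' μ) (hA' : eLpNorm A' (3 / 2) μ < ⊤) (hB' : eLpNorm B' 3 μ < ⊤)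
    (hdA : eLpNorm (A - A') (3 / 2) μ < ⊤) (hdB : eLpNorm (B - B') 3 μ < ⊤) {c : X → ℝ}
    (hc : AEStronglyMeasurable c μ) {C : ℝ} (hC : ∀ x, ‖c x‖ ≤ C) :
    |(∫ x, c x * (A x * B x) ∂μ) - ∫ x, c x * (A' x * B' x) ∂μ| ≤
      (ENNReal.ofReal C * (eLpNorm (A - A') (3 / 2) μ * (eLpNorm (B - B') 3 μ + eLpNorm B' 3 μ) +
        eLpNorm A' (3 / 2) μ * eLpNorm (B - B') 3 μ)).toReal := by
  have hT1 := holderTriple_threeHalves_three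
  -- memberships
  have hA'p : MemLp A' (3 / 2) μ := ⟨hA'm, hA'⟩
  have hB'p : MemLp B' 3 μ := ⟨hB'm, hB'⟩
  have hdAp : MemLp (A - A') (3 / 2) μ := ⟨hAm.sub hA'm, hdA⟩
  have hdBp : MemLp (B - B') 3 μ := ⟨hBm.sub hB'm, hdB⟩
  have hAp : MemLp A (3 / 2) μ := by simpa using hdAp.add hA'p
  have hBp : MemLp B 3 μ := by simpa using hdBp.add hB'p
  have hB3 : eLpNorm B 3 μ ≤ eLpNorm (B - B') 3 μ + eLpNorm B' 3 μ := by
    have h := eLpNorm_add_le (hBm.sub hB'm) hB'm (by norm_num : (1 : ℝ≥0∞) ≤ 3) (μ := μ)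
    simpa using h
  -- both pairings are integrable
  have hi : Integrable (fun x => c x * (A x * B x)) μ :=
    (hAp.integrable_mul hBp).bdd_mul hc (Eventually.of_forall hC)
  have hi' : Integrable (fun x => c x * (A' x * B' x)) μ :=
    (hA'p.integrable_mul hB'p).bdd_mul hc (Eventually.of_forall hC)
  rw [← integral_sub hi hi']
  refine (abs_integral_le_toReal_lintegral _).trans (ENNReal.toReal_mono ?_ ?_)
  · refine ENNReal.mul_ne_top ENNReal.ofReal_ne_top (ENNReal.add_ne_top.2 ⟨?_, ?_⟩)
    · exact ENNReal.mul_ne_top hdA.ne (ENNReal.add_ne_top.2 ⟨hdB.ne, hB'.ne⟩)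
    · exact ENNReal.mul_ne_top hA'.ne hdB.ne
  -- pointwise: `‖c (AB - A'B')‖ₑ ≤ C (‖A - A'‖ₑ ‖B‖ₑ + ‖A'‖ₑ ‖B - B'‖ₑ)`
  have hpt : ∀ x, ‖c x * (A x * B x) - c x * (A' x * B' x)‖ₑ ≤
      ENNReal.ofReal C * (‖(A x - A' x) * B x‖ₑ + ‖A' x * (B x - B' x)‖ₑ) := fun x => by
    have heq : c x * (A x * B x) - c x * (A' x * B' x) =
        c x * ((A x - A' x) * B x + A' x * (B x - B' x)) := by ring
    rw [heq, enorm_mul]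
    gcongr
    · rw [← ofReal_norm]
      exact ENNReal.ofReal_le_ofReal (hC x)
    · exact enorm_add_le _ _
  calc ∫⁻ x, ‖c x * (A x * B x) - c x * (A' x * B' x)‖ₑ ∂μ
      ≤ ∫⁻ x, ENNReal.ofReal C * (‖(A x - A' x) * B x‖ₑ + ‖A' x * (B x - B' x)‖ₑ) ∂μ :=
        lintegral_mono hpt
    _ = ENNReal.ofReal C * ((∫⁻ x, ‖(A x - A' x) * B x‖ₑ ∂μ) + ∫⁻ x, ‖A' x * (B x - B' x)‖ₑ ∂μ) := by
        have hm1 : AEMeasurable (fun x => ‖(A x - A' x) * B x‖ₑ) μ := ((hAm.sub hA'm).mul hBm).enorm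
        have hm2 : AEMeasurable (fun x => ‖A' x * (B x - B' x)‖ₑ) μ := (hA'm.mul (hBm.sub hB'm)).enorm
        have hm12 : AEMeasurable (fun x => ‖(A x - A' x) * B x‖ₑ + ‖A' x * (B x - B' x)‖ₑ) μ :=
          hm1.add hm2
        rw [lintegral_const_mul'' _ hm12, lintegral_add_left' hm1]
    _ ≤ ENNReal.ofReal C * (eLpNorm (A - A') (3 / 2) μ * eLpNorm B 3 μ +
          eLpNorm A' (3 / 2) μ * eLpNorm (B - B') 3 μ) := by
        gcongr
        · exact lintegral_enorm_mul_le_threeHalves_three (hAm.sub hA'm) hBm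
        · exact lintegral_enorm_mul_le_threeHalves_three hA'm (hBm.sub hB'm)
    _ ≤ _ := by gcongr

/-- **Pairings converge along `L^{3/2}`- and `L³`-convergent sequences**: if
`‖Aₙ - A‖_{3/2} → 0`, `‖Bₙ - B‖₃ → 0` with `A ∈ L^{3/2}`, `B ∈ L³`, and `c` is a bounded measurable
weight, then `∫ c Aₙ Bₙ → ∫ c A B`. [folklore] -/
theorem tendsto_integral_mul_mul {A : ℕ → X → ℝ} {A' : X → ℝ} {B : ℕ → X → ℝ} {B' : X → ℝ}
    (hAm : ∀ n, AEStronglyMeasurable (A n) μ) (hA'm : AEStronglyMeasurable A' μ)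
    (hBm : ∀ n, AEStronglyMeasurable (B n) μ) (hB'm : AEStronglyMeasurable B' μ)
    (hA' : eLpNorm A' (3 / 2) μ < ⊤) (hB' : eLpNorm B' 3 μ < ⊤)
    (hA : Tendsto (fun n => eLpNorm (A n - A') (3 / 2) μ) atTop (𝓝 0))
    (hB : Tendsto (fun n => eLpNorm (B n - B') 3 μ) atTop (𝓝 0)) {c : X → ℝ}
    (hc : AEStronglyMeasurable c μ) {C : ℝ} (hC : ∀ x, ‖c x‖ ≤ C) :
    Tendsto (fun n => ∫ x, c x * (A n x * B n x) ∂μ) atTop (𝓝 (∫ x, c x * (A' x * B' x) ∂μ)) := by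
  set bd : ℕ → ℝ≥0∞ := fun n => ENNReal.ofReal C *
    (eLpNorm (A n - A') (3 / 2) μ * (eLpNorm (B n - B') 3 μ + eLpNorm B' 3 μ) +
      eLpNorm A' (3 / 2) μ * eLpNorm (B n - B') 3 μ) with hbd
  have hbdt : Tendsto bd atTop (𝓝 0) := by
    have h1 : Tendsto (fun n => eLpNorm (B n - B') 3 μ + eLpNorm B' 3 μ) atTop
        (𝓝 (0 + eLpNorm B' 3 μ)) := hB.add tendsto_const_nhds
    have h2 := ENNReal.Tendsto.mul hA (Or.inr (by simpa using hB'.ne)) h1 (Or.inr ENNReal.zero_ne_top)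
    have h3 := ENNReal.Tendsto.const_mul (a := eLpNorm A' (3 / 2) μ) hB (Or.inr hA'.ne)
    rw [zero_mul] at h2
    rw [mul_zero] at h3
    have h4 := h2.add h3
    rw [add_zero] at h4
    have h5 := ENNReal.Tendsto.const_mul (a := ENNReal.ofReal C) h4 (Or.inr ENNReal.ofReal_ne_top)
    simpa [hbd] using h5
  have hbdr : Tendsto (fun n => (bd n).toReal) atTop (𝓝 0) := by
    have h := (ENNReal.tendsto_toReal ENNReal.zero_ne_top).comp hbdt
    rw [ENNReal.toReal_zero] at h
    exact h
  have hevA : ∀ᶠ n in atTop, eLpNorm (A n - A') (3 / 2) μ < ⊤ := by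
    filter_upwards [hA (gt_mem_nhds (show (0 : ℝ≥0∞) < 1 from one_pos))] with n hn
    exact lt_trans hn ENNReal.one_lt_top
  have hevB : ∀ᶠ n in atTop, eLpNorm (B n - B') 3 μ < ⊤ := by
    filter_upwards [hB (gt_mem_nhds (show (0 : ℝ≥0∞) < 1 from one_pos))] with n hn
    exact lt_trans hn ENNReal.one_lt_top
  rw [tendsto_iff_norm_sub_tendsto_zero]
  refine squeeze_zero' (Eventually.of_forall fun n => norm_nonneg _) ?_ hbdr
  filter_upwards [hevA, hevB] with n hnA hnB
  rw [Real.norm_eq_abs]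
  exact abs_integral_mul_mul_sub_le (hAm n) hA'm (hBm n) hB'm hA' hB' hnA hnB hc hC

end Pairing

end Literature.Analysis.FunctionSpaces
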